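import Literature.Claims.NS.Chaabani2020
import Literature.Claims.NS.ClayTorusMeanZeroBridge
import HarnessLib

/-!
# Solo salvage for claim C22 `Chaabani2020` (cell `ns-claims`, D-0090): the classical frame of the
# interval-continuation argument, kernel-discharged

Claim skeleton: `Literature/Claims/NS/Chaabani2020.lean` (typist `ns-claims-typist-5`, p472010): A. Chaabani,
arXiv:2004.06956 v1 (2020), Thm 1.3 p.3 (global strong solutions of the periodic Navier–Stokes equations for
all `H¹_σ(𝕋³)` data) by an interval continuation driven by the sign of `F_m = Σ_{|k|≤m}|û| − Σ_{|k|>m}|û|`;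
the weight of the claim sits on the termination step `LastIntervalSign` / `Step_6` (l.274–282 p.8,
refuter-8's lane). The composition `claim_of_steps` and the Clay link `clay_of_claimed_of_delta` are proved
in the skeleton.

This file (seat `ns-claims-salvage-p2`, salvage lane of C22) kernel-discharges the CLASSICAL items around the
locator:

* `step1_holds : Step_1` — Thm 1.2 / §2 l.156–188 / l.282–284 in the charitable reading: the maximal
  classical solution with the `H¹` blow-up alternative for smooth divergence-free mean-zero data on `𝕋³`.
  It is VERBATIM the tree's `Literature.Analysis.FluidPDE.Torus.exists_maximal_classicalNS`
  (Robinson–Rodrigo–Sadowski 2016 §6.3 p.108, §8.1 p.122; Leray 1934) — original source RRS/Leray, not the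
  claim.
* `step5Display_corrected_holds c₁ : Step_5Display c₁ (correctedRule c₁)` — the elementary display of
  l.242–248 p.7 in the E1-corrected reading (what «m^{−1/2} < (ν/(2c₁^*))‖∇u(t_0)‖^{−1}» states): above half
  the corrected interval wavenumber the dissipation factor is positive. (The printed instance
  `Step_5Display c₁ (printedRule c₁)` is false for every `c₁ > 1` — the typist's erratum E1, refuter's
  column.)
* `clayDelta_holds : ClayDelta` — the typed Clay delta (torus-level global regularity for smooth mean-zero
  data at every `ν > 0` ⇒ Clay (B)) is a THEOREM: lift to `ℝ³` and undo the Galilean normalisation of the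
  mean (`ClayVariants.clayPeriodic_regularity_of_torus_meanZero`, `Literature/Claims/NS/ClayTorusMeanZeroBridge.lean`).
  Hence `clay_of_claimed : ClaimedTheorem → clayPeriodic.Regularity` with NO delta, and the errata reading too.

Solo lane (`Theorems/SoloSalvage<Slug>.lean`, no item).

WHAT THIS IS NOT: not a claim about NS regularity or blow-up; not a claim about any author beyond the
typed locator.
-/

noncomputable section

open Set MeasureTheory

-- The mandated landing namespace repeats the summit name by design (D-0017).
set_option linter.dupNamespace false

namespace Summit.NavierStokesRegularity.NavierStokesRegularity.Theorems

namespace Chaabani2020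

open Literature.Claims.NS.Chaabani2020 Literature.Claims.NS Literature.Analysis Literature.Analysis.FluidPDE
  Literature.Analysis.FunctionSpaces

/-- **Step 1 HOLDS (Thm 1.2 l.128–130, §2 l.156–188, continuation sentence l.282–284, charitable reading)**:
the maximal classical solution from a smooth divergence-free mean-zero datum on `𝕋³` with the `H¹` blow-up
alternative — verbatim the tree's `Torus.exists_maximal_classicalNS` (Robinson–Rodrigo–Sadowski 2016 §6.3
p.108 / §8.1 p.122: «either `u` is strong for all positive times … or there exists a time `T*` when `‖∇u‖`
blows up»; Leray 1934). [cite: RobinsonRodrigoSadowskiCUP2016, §6.3 p. 108 and §8.1 p. 122] -/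
theorem step1_holds : Literature.Claims.NS.Chaabani2020.Step_1 := fun _ν hν _u₀ hu₀ hdiv hmean =>
  Torus.exists_maximal_classicalNS (d := Fin 3) (by simp) hν hu₀ hdiv hmean

/-- **The display l.242–248 p.7 in the E1-corrected reading HOLDS**: for `ν, E, m > 0` with
`m > (8c₁/ν²)/2 · E = 4c₁E/ν²` one has `2√c₁ · √E/√m < ν` (for `c₁ ≤ 0` trivially, `√c₁ = 0`). Elementary
real arithmetic; this is what «m^{−1/2} < (ν/(2c₁^*))‖∇u(t_0)‖^{−1}» (l.246–248) says with `E = ‖∇u(t_0)‖²`.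
[cite: Chaabani2020, §2 l.242–248 p. 7] -/
theorem step5Display_corrected_holds (c₁ : ℝ) : Step_5Display c₁ (correctedRule c₁) := by
  intro ν E m hν hE hm hrule
  have hsm : 0 < Real.sqrt m := Real.sqrt_pos.2 hm
  rw [correctedRule] at hrule
  -- `4 c₁ E < ν² m`
  have h4 : 4 * c₁ * E < ν ^ 2 * m := by
    have hν2 : 0 < ν ^ 2 := by positivity
    have := mul_lt_mul_of_pos_right hrule hν2
    have h' : 8 * c₁ / ν ^ 2 / 2 * E * ν ^ 2 = 4 * c₁ * E := by
      field_simp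
      ring
    rw [h'] at this
    linarith [this]
  rcases le_or_gt c₁ 0 with hc | hc
  · rw [Real.sqrt_eq_zero'.2 hc]
    simpa using hν
  · have hlhs : 2 * Real.sqrt c₁ * (Real.sqrt E / Real.sqrt m) =
        Real.sqrt (4 * c₁ * E) / Real.sqrt m := by
      rw [show (4 : ℝ) * c₁ * E = (2 ^ 2) * (c₁ * E) by ring, Real.sqrt_mul (by positivity),
        Real.sqrt_sq (by norm_num), Real.sqrt_mul hc.le]
      ring
    rw [hlhs, div_lt_iff₀ hsm]
    have hrhs : ν * Real.sqrt m = Real.sqrt (ν ^ 2 * m) := by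
      rw [Real.sqrt_mul (by positivity), Real.sqrt_sq hν.le]
    rw [hrhs]
    exact Real.sqrt_lt_sqrt (by positivity) h4

/-- **The typed Clay delta is a THEOREM**: torus-level global classical solvability for smooth
divergence-free mean-zero data at every `ν > 0` implies Clay (B) — lift to `ℝ³`
(`IsClassicalNSSolutionOn.of_torus_holds`) and undo the Galilean normalisation of the mean
(`IsClassicalNSSolutionOn.galileanBoost_const`), assembled in
`ClayVariants.clayPeriodic_regularity_of_torus_meanZero`. [cite: FeffermanClay2006, (B) with (8) (10) (11), p. 2] -/
theorem clayDelta_holds : Literature.Claims.NS.Chaabani2020.ClayDelta := fun H =>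
  (ClayVariants.clayPeriodic_regularity_of_torus_meanZero H).1

/-- **Clay link with no delta**: the claimed theorem (Thm 1.3 at the smooth mean-zero level) implies Clay (B)
AS PRINTED (`clay_of_claimed_of_delta` with `clayDelta_holds`). MAP Clay cell: «(B); STRONGER (Δ4 data,
Δ6 uniform bound); composes YES; no wrong-problem axis». [cite: FeffermanClay2006, (B) p. 2] -/
theorem clay_of_claimed (h : Literature.Claims.NS.Chaabani2020.ClaimedTheorem) : ClayVariants.clayPeriodic.Regularity :=
  clay_of_claimed_of_delta clayDelta_holds h

/-- The errata reading of (B) (velocity AND pressure periodic) follows as well: the reconstructed pressure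
is the Galilean translate of a periodic lift. [cite: FeffermanClay2006, (B) p. 2 and errata p. 6] -/
theorem clayErrata_of_claimed (h : Literature.Claims.NS.Chaabani2020.ClaimedTheorem) : ClayVariants.clayPeriodicErrata.Regularity :=
  (ClayVariants.clayPeriodic_regularity_of_torus_meanZero fun ν hν u₀ hu₀ hdiv hmean => by
    obtain ⟨u, p, hsol, hu0, -⟩ := h ν hν u₀ hu₀ hdiv hmean
    exact ⟨u, p, hsol, hu0⟩).2

end Chaabani2020

end Summit.NavierStokesRegularity.NavierStokesRegularity.Theorems
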